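import Literature.MathematicalPhysics.QuantumManyBody.CoulombBoxIntegrability
import Literature.MathematicalPhysics.QuantumManyBody.SlidingLemmaScaled
import Literature.MathematicalPhysics.QuantumManyBody.LiebYngvasonBoxBound
import HarnessLib

/-!
# The Lieb–Solovej small-box jellium Hamiltonian `H^n_ℓ` and its ground-state energy

Topic `Literature/MathematicalPhysics/QuantumManyBody` (the charged Bose gas, `JelliumBoseGas.foldyLaw`;
definitions for [LiebSolovej2001, §3 (3.9), Lemma 3.3] and everything after it). After the
sliding localization the lower bound on the jellium energy is reduced to the `n`-particle
Hamiltonian of ONE small box `Λ_ℓ` with Neumann boundary conditions [LiebSolovej2001, (3.9)]: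

`H^n_ℓ = ∑ⱼ (-κ Δ_{ℓ,j} - ρ ∫ w(xⱼ, y) dy) + ∑_{i<j} w(xᵢ, xⱼ) + ½ρ² ∬ w(x, y) dx dy`,
`w(x, y) = θ(x) Y_ν(x - y) θ(y)`, `Y_ν(x) = e^{-ν|x|}/|x|`,

with `θ = χ_ℓ` the localization function of the box (`0 ≤ θ ≤ 1`, supported in the box),
`ν = ω(t)/ℓ`, `κ = ½γ⁻¹` in the source's units; the background is the full smeared background
`ρθ` (boxes of "the second kind"; for boundary boxes the missing background is added at a cost,
[LiebSolovej2001, p. 9]). This file DEFINES the corresponding variational objects in the tree's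
vocabulary (`C¹` Neumann trial states `BoseGas.NeumannTrialState n ℓ` on the open box
`Λ_ℓ^n = boxN n ℓ`, `ℝ≥0∞` expectations, real energies, general kinetic coefficient `κ` and
coupling `g`):

* `JelliumBoseGas.yukawa ν` — `Y_ν`; `smearedBackground θ ν x = ∫ θ(y) Y_ν(x - y) dy` (the
  potential `∫ w(x,y)dy / θ(x)` of the smeared background);
* `boxPair θ ν Y = ∑_{i<j} w(yᵢ, yⱼ)`, `boxOneBody θ ν Y = ∑ⱼ θ(yⱼ)U(yⱼ) = ∑ⱼ ∫ w(yⱼ, y) dy`,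
  `boxBackgroundSelfEnergy θ ν = ½ ∬ w`;
* `boxKinetic`, `boxPairExpectation`, `boxOneBodyExpectation` — `∫_{Λ^n}|∇Φ|²`,
  `∫_{Λ^n} (∑_{i<j} w)|Φ|²`, `∫_{Λ^n} (∑ⱼ∫w(yⱼ,y)dy)|Φ|²` of a Neumann trial state (`ℝ≥0∞`);
* `boxEnergy κ g ρ θ ν Φ = κ T + g (PP - ρ PB + ρ² BB)` — **the quadratic form of `H^n_ℓ`**
  (real; `g = 1`, `κ = ½γ⁻¹` is (3.9), and `γ H^n_ℓ` of Lemma 3.3 is `κ = ½`, `g = γ`);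
* `IsBoseSymmetric`, `boxGroundStateEnergy κ g ρ θ ν n ℓ` — **`inf Spec H^n_ℓ` on the bosonic
  sector** as the infimum of `boxEnergy` over Bose-symmetric Neumann trial states.

API: nonnegativity, measurability and bounds of the potentials (`0 ≤ U ≤ M‖Y_ν‖₁` for
`0 ≤ θ ≤ M`), finiteness of the three expectations, the a-priori bound
`boxEnergy ≥ -gρ n M²‖Y_ν‖₁`, existence of Bose-symmetric trial states (the constant), the
variational principle `boxGroundStateEnergy_le`, and the scaling form of the variational
principle for unnormalised wave functions (`boxGroundStateEnergy_mul_le`), which is the form used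
when particles outside the box are frozen [LiebSolovej2001, proof of Lemma 3.2].

## References

* [LiebSolovej2001] E. H. Lieb, J. P. Solovej, Commun. Math. Phys. 217 (2001) 127–163, §3,
  (3.9) and Lemmas 3.2–3.3 (arXiv:cond-mat/0007425, pp. 8–9).
-/

noncomputable section

open MeasureTheory Set Filter Real
open scoped ENNReal NNReal Topology

namespace Literature.MathematicalPhysics.QuantumManyBody.JelliumBoseGas

open BoseGas Coulomb

/-! ### The potentials -/

/-- The Yukawa potential `Y_ν(x) = e^{-ν|x|}/|x|` (`= 0` at the origin).
[cite: LiebSolovej2001, §3 (before Lemma 3.1)] -/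
def yukawa (ν : ℝ) (x : Space) : ℝ := Real.exp (-(ν * ‖x‖)) / ‖x‖

/-- The potential of the smeared background `θ`: `U(x) = ∫ θ(y) Y_ν(x - y) dy`, so that
`∫ w(x, y) dy = θ(x) U(x)` for `w(x,y) = θ(x)Y_ν(x-y)θ(y)`. [cite: LiebSolovej2001, (3.9)] -/
def smearedBackground (θ : Space → ℝ) (ν : ℝ) (x : Space) : ℝ := ∫ y, θ y * yukawa ν (x - y)

/-- The pair potential of the box, `∑_{i<j} w(yᵢ, yⱼ)`, `w(x,y) = θ(x)Y_ν(x-y)θ(y)`.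
[cite: LiebSolovej2001, (3.9)] -/
def boxPair (θ : Space → ℝ) (ν : ℝ) {n : ℕ} (Y : Config n) : ℝ :=
  ∑ i, ∑ j with i < j, θ (Y i) * yukawa ν (Y i - Y j) * θ (Y j)

/-- The particle–background potential of the box at unit density, `∑ⱼ ∫ w(yⱼ, y) dy = ∑ⱼ θ(yⱼ)U(yⱼ)`.
[cite: LiebSolovej2001, (3.9)] -/
def boxOneBody (θ : Space → ℝ) (ν : ℝ) {n : ℕ} (Y : Config n) : ℝ :=
  ∑ j, θ (Y j) * smearedBackground θ ν (Y j)

/-- The background self-energy of the box at unit density, `½ ∬ w(x, y) dx dy = ½ ∫ θ U`.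
[cite: LiebSolovej2001, (3.9)] -/
def boxBackgroundSelfEnergy (θ : Space → ℝ) (ν : ℝ) : ℝ :=
  1 / 2 * ∫ x, θ x * smearedBackground θ ν x

/-! ### Expectations and the energy functional -/

variable {n : ℕ} {ℓ : ℝ}

/-- The Neumann kinetic energy `∫_{Λ_ℓ^n} |∇Φ|²` of a trial state. [cite: LiebSolovej2001, (3.9)] -/
def boxKinetic (Φ : NeumannTrialState n ℓ) : ℝ≥0∞ :=
  ∫⁻ Y in boxN n ℓ, kineticDensity Φ.ψ Y

/-- The pair energy `∫_{Λ^n} (∑_{i<j} w(yᵢ,yⱼ)) |Φ|²` (for `θ ≥ 0` the integrand is nonnegative).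
[cite: LiebSolovej2001, (3.9)] -/
def boxPairExpectation (θ : Space → ℝ) (ν : ℝ) (Φ : NeumannTrialState n ℓ) : ℝ≥0∞ :=
  ∫⁻ Y in boxN n ℓ, ENNReal.ofReal (boxPair θ ν Y) * (‖Φ.ψ Y‖₊ : ℝ≥0∞) ^ 2

/-- The particle–background energy at unit density, `∫_{Λ^n} (∑ⱼ ∫ w(yⱼ,y)dy) |Φ|²`.
[cite: LiebSolovej2001, (3.9)] -/
def boxOneBodyExpectation (θ : Space → ℝ) (ν : ℝ) (Φ : NeumannTrialState n ℓ) : ℝ≥0∞ :=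
  ∫⁻ Y in boxN n ℓ, ENNReal.ofReal (boxOneBody θ ν Y) * (‖Φ.ψ Y‖₊ : ℝ≥0∞) ^ 2

/-- **The quadratic form of `H^n_ℓ`** [LiebSolovej2001, (3.9)], with kinetic coefficient `κ`,
coupling `g` and background density `ρ`:
`⟨Φ, H^n_ℓ Φ⟩ = κ ∫|∇Φ|² + g (∫ ∑_{i<j} w |Φ|² - ρ ∫ ∑ⱼ∫w(yⱼ,y)dy |Φ|² + ρ² · ½∬w)`
((3.9) is `κ = ½γ⁻¹`, `g = 1`, `θ = χ_ℓ`, `ν = ω(t)/ℓ`). [cite: LiebSolovej2001, (3.9)] -/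
def boxEnergy (κ g ρ : ℝ) (θ : Space → ℝ) (ν : ℝ) (Φ : NeumannTrialState n ℓ) : ℝ :=
  κ * (boxKinetic Φ).toReal + g * ((boxPairExpectation θ ν Φ).toReal -
    ρ * (boxOneBodyExpectation θ ν Φ).toReal + ρ ^ 2 * boxBackgroundSelfEnergy θ ν)

/-- Bose symmetry of an `n`-particle wave function. [cite: LiebSolovej2001, Lemma 3.2 ("considered
as a bosonic Hamiltonian")] -/
def IsBoseSymmetric {n : ℕ} (ψ : Config n → ℂ) : Prop :=
  ∀ (σ : Equiv.Perm (Fin n)) (X : Config n), ψ (X ∘ σ) = ψ X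

/-- **The bosonic ground-state energy `inf Spec H^n_ℓ` of the small box** as the infimum of the
quadratic form over Bose-symmetric `C¹` Neumann trial states (a form core).
[cite: LiebSolovej2001, Lemmas 3.2–3.3] -/
def boxGroundStateEnergy (κ g ρ : ℝ) (θ : Space → ℝ) (ν : ℝ) (n : ℕ) (ℓ : ℝ) : ℝ :=
  ⨅ Φ : {Φ : NeumannTrialState n ℓ // IsBoseSymmetric Φ.ψ}, boxEnergy κ g ρ θ ν Φ.1

/-! ### API: the Yukawa potential and the smeared background -/

/-- `Y_ν` unfolded. [folklore] -/
theorem yukawa_eq (ν : ℝ) : yukawa ν = fun x : Space => Real.exp (-(ν * ‖x‖)) / ‖x‖ := rfl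

/-- `Y_ν ≥ 0`. [folklore] -/
theorem yukawa_nonneg (ν : ℝ) (x : Space) : 0 ≤ yukawa ν x :=
  div_nonneg (Real.exp_pos _).le (norm_nonneg _)

/-- `Y_ν(x) ≤ |x|⁻¹` for `ν ≥ 0`. [folklore] -/
theorem yukawa_le_inv_norm {ν : ℝ} (hν : 0 ≤ ν) (x : Space) : yukawa ν x ≤ ‖x‖⁻¹ := by
  rw [yukawa, div_eq_mul_inv]
  refine mul_le_of_le_one_left (inv_nonneg.2 (norm_nonneg _)) ?_
  rw [Real.exp_le_one_iff]
  nlinarith [norm_nonneg x]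

/-- `Y_ν` is measurable. [folklore] -/
theorem measurable_yukawa (ν : ℝ) : Measurable (yukawa ν) :=
  (Real.measurable_exp.comp (measurable_const.mul measurable_norm).neg).div measurable_norm

/-- `Y_ν ∈ L¹(ℝ³)` for `ν > 0`. [folklore] -/
theorem integrable_yukawa' {ν : ℝ} (hν : 0 < ν) : Integrable (yukawa ν) :=
  integrable_yukawa_exp hν

/-- `Y_ν(-x) = Y_ν(x)`. [folklore] -/
theorem yukawa_neg (ν : ℝ) (x : Space) : yukawa ν (-x) = yukawa ν x := by
  simp [yukawa, norm_neg]

section Background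

variable {θ : Space → ℝ} {ν M : ℝ}

/-- `U ≥ 0` for `θ ≥ 0`. [folklore] -/
theorem smearedBackground_nonneg (hθ : ∀ x, 0 ≤ θ x) (ν : ℝ) (x : Space) :
    0 ≤ smearedBackground θ ν x :=
  integral_nonneg fun y => mul_nonneg (hθ y) (yukawa_nonneg ν _)

/-- `U(x) ≤ M ‖Y_ν‖₁` for `0 ≤ θ ≤ M` measurable, `ν > 0`. [folklore] -/
theorem smearedBackground_le (hθ : ∀ x, 0 ≤ θ x) (hM : ∀ x, θ x ≤ M) (hν : 0 < ν) (x : Space) :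
    smearedBackground θ ν x ≤ M * ∫ y, yukawa ν y := by
  have hM0 : 0 ≤ M := (hθ 0).trans (hM 0)
  have hYx : Integrable fun y : Space => yukawa ν (x - y) := (integrable_yukawa' hν).comp_sub_left x
  calc smearedBackground θ ν x ≤ ∫ y, M * yukawa ν (x - y) := by
        refine integral_mono_of_nonneg (Eventually.of_forall fun y =>
          mul_nonneg (hθ y) (yukawa_nonneg ν _)) (hYx.const_mul M)
          (Eventually.of_forall fun y => ?_)
        exact mul_le_mul_of_nonneg_right (hM y) (yukawa_nonneg ν _)
    _ = M * ∫ y, yukawa ν y := by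
        rw [integral_const_mul, integral_sub_left_eq_self (yukawa ν) volume x]

/-- `U` is measurable (parametric integral of a jointly measurable integrand). [folklore] -/
theorem measurable_smearedBackground (hθm : Measurable θ) (ν : ℝ) :
    Measurable (smearedBackground θ ν) := by
  have hf : Measurable fun q : Space × Space => θ q.2 * yukawa ν (q.1 - q.2) :=
    (hθm.comp measurable_snd).mul ((measurable_yukawa ν).comp (measurable_fst.sub measurable_snd))
  exact (hf.stronglyMeasurable.integral_prod_right' (ν := (volume : Measure Space))).measurable

end Background

/-! ### API: the pair and one-body potentials -/

section Potentials

variable {θ : Space → ℝ} {ν M : ℝ}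

/-- `∑_{i<j} w(yᵢ,yⱼ) ≥ 0` for `θ ≥ 0`. [folklore] -/
theorem boxPair_nonneg (hθ : ∀ x, 0 ≤ θ x) (ν : ℝ) (Y : Config n) : 0 ≤ boxPair θ ν Y :=
  Finset.sum_nonneg fun _ _ => Finset.sum_nonneg fun _ _ =>
    mul_nonneg (mul_nonneg (hθ _) (yukawa_nonneg ν _)) (hθ _)

/-- `∑_{i<j} w(yᵢ,yⱼ) ≤ M² ∑_{i<j} |yᵢ - yⱼ|⁻¹` for `0 ≤ θ ≤ M`, `ν ≥ 0`. [folklore] -/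
theorem boxPair_le (hθ : ∀ x, 0 ≤ θ x) (hM : ∀ x, θ x ≤ M) (hν : 0 ≤ ν) (Y : Config n) :
    boxPair θ ν Y ≤ M ^ 2 * ∑ i, ∑ j with i < j, ‖Y i - Y j‖⁻¹ := by
  have hM0 : 0 ≤ M := (hθ 0).trans (hM 0)
  rw [boxPair, Finset.mul_sum]
  refine Finset.sum_le_sum fun i _ => ?_
  rw [Finset.mul_sum]
  refine Finset.sum_le_sum fun j _ => ?_
  calc θ (Y i) * yukawa ν (Y i - Y j) * θ (Y j) ≤ M * ‖Y i - Y j‖⁻¹ * M := by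
        refine mul_le_mul (mul_le_mul (hM _) (yukawa_le_inv_norm hν _) (yukawa_nonneg ν _) hM0)
          (hM _) (hθ _) (mul_nonneg hM0 (inv_nonneg.2 (norm_nonneg _)))
    _ = M ^ 2 * ‖Y i - Y j‖⁻¹ := by ring

/-- The pair potential is measurable on configuration space. [folklore] -/
theorem measurable_boxPair (hθm : Measurable θ) (ν : ℝ) :
    Measurable fun Y : Config n => boxPair θ ν Y := by
  unfold boxPair
  refine Finset.measurable_sum _ fun i _ => Finset.measurable_sum _ fun j _ => ?_
  have h1 : Measurable fun Y : Config n => Y i - Y j :=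
    (measurable_pi_apply i).sub (measurable_pi_apply j)
  exact ((hθm.comp (measurable_pi_apply i)).mul ((measurable_yukawa ν).comp h1)).mul
    (hθm.comp (measurable_pi_apply j))

/-- `∑ⱼ θ(yⱼ)U(yⱼ) ≥ 0` for `θ ≥ 0`. [folklore] -/
theorem boxOneBody_nonneg (hθ : ∀ x, 0 ≤ θ x) (ν : ℝ) (Y : Config n) : 0 ≤ boxOneBody θ ν Y :=
  Finset.sum_nonneg fun _ _ => mul_nonneg (hθ _) (smearedBackground_nonneg hθ ν _)

/-- `∑ⱼ θ(yⱼ)U(yⱼ) ≤ n M² ‖Y_ν‖₁` for `0 ≤ θ ≤ M` measurable, `ν > 0`. [folklore] -/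
theorem boxOneBody_le (hθ : ∀ x, 0 ≤ θ x) (hM : ∀ x, θ x ≤ M) (hν : 0 < ν) (Y : Config n) :
    boxOneBody θ ν Y ≤ n * (M * (M * ∫ y, yukawa ν y)) := by
  have hM0 : 0 ≤ M := (hθ 0).trans (hM 0)
  calc boxOneBody θ ν Y ≤ ∑ _j : Fin n, M * (M * ∫ y, yukawa ν y) :=
        Finset.sum_le_sum fun _ _ => mul_le_mul (hM _) (smearedBackground_le hθ hM hν _)
          (smearedBackground_nonneg hθ ν _) hM0
    _ = n * (M * (M * ∫ y, yukawa ν y)) := by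
        rw [Finset.sum_const, Finset.card_univ, Fintype.card_fin, nsmul_eq_mul]

/-- The one-body potential is measurable on configuration space. [folklore] -/
theorem measurable_boxOneBody (hθm : Measurable θ) (ν : ℝ) :
    Measurable fun Y : Config n => boxOneBody θ ν Y := by
  unfold boxOneBody
  exact Finset.measurable_sum _ fun j _ => (hθm.comp (measurable_pi_apply j)).mul
    ((measurable_smearedBackground hθm ν).comp (measurable_pi_apply j))

end Potentials

/-! ### API: finiteness of the expectations -/

section Finiteness

variable {θ : Space → ℝ} {ν M : ℝ}

/-- `|Φ|²` is measurable. [folklore] -/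
theorem measurable_normSq_trial (Φ : NeumannTrialState n ℓ) :
    Measurable fun Y : Config n => (‖Φ.ψ Y‖₊ : ℝ≥0∞) ^ 2 :=
  measurable_normSq Φ.contDiff.continuous

/-- The Neumann kinetic energy of a `C¹` trial state on the (bounded) box is finite. [folklore] -/
theorem boxKinetic_ne_top (Φ : NeumannTrialState n ℓ) : boxKinetic Φ ≠ ⊤ := by
  obtain ⟨C, hC⟩ := (isCompact_closedBall (0 : Config n) (3 * |ℓ|)).exists_bound_of_continuousOn
    (Φ.contDiff.continuous_fderiv one_ne_zero).continuousOn
  unfold boxKinetic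
  refine ne_top_of_le_ne_top ?_ (setLIntegral_mono measurable_const fun X hX =>
    kineticDensity_le_of_norm_fderiv_le (hC X (boxN_subset_closedBall n ℓ hX)))
  rw [setLIntegral_const]
  exact ENNReal.mul_ne_top (ENNReal.mul_ne_top (ENNReal.natCast_ne_top n)
    (ENNReal.mul_ne_top (by norm_num) (ENNReal.pow_ne_top ENNReal.ofReal_ne_top)))
    (volume_boxN_lt_top n ℓ).ne

/-- The particle–background expectation is at most `n M² ‖Y_ν‖₁` (the state is normalised).
[folklore] -/
theorem boxOneBodyExpectation_le (hθ : ∀ x, 0 ≤ θ x) (hM : ∀ x, θ x ≤ M) (hν : 0 < ν)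
    (Φ : NeumannTrialState n ℓ) :
    boxOneBodyExpectation θ ν Φ ≤ ENNReal.ofReal (n * (M * (M * ∫ y, yukawa ν y))) := by
  unfold boxOneBodyExpectation
  calc ∫⁻ Y in boxN n ℓ, ENNReal.ofReal (boxOneBody θ ν Y) * (‖Φ.ψ Y‖₊ : ℝ≥0∞) ^ 2
      ≤ ∫⁻ Y in boxN n ℓ, ENNReal.ofReal (n * (M * (M * ∫ y, yukawa ν y))) *
          (‖Φ.ψ Y‖₊ : ℝ≥0∞) ^ 2 :=
        lintegral_mono fun Y => mul_le_mul' (ENNReal.ofReal_le_ofReal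
          (boxOneBody_le hθ hM hν Y)) le_rfl
    _ = ENNReal.ofReal (n * (M * (M * ∫ y, yukawa ν y))) := by
        rw [lintegral_const_mul' _ _ ENNReal.ofReal_ne_top, Φ.norm_eq, mul_one]

/-- The particle–background expectation is finite. [folklore] -/
theorem boxOneBodyExpectation_ne_top (hθ : ∀ x, 0 ≤ θ x) (hM : ∀ x, θ x ≤ M) (hν : 0 < ν)
    (Φ : NeumannTrialState n ℓ) : boxOneBodyExpectation θ ν Φ ≠ ⊤ :=
  ne_top_of_le_ne_top ENNReal.ofReal_ne_top (boxOneBodyExpectation_le hθ hM hν Φ)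

/-- The pair expectation of any bounded `ψ` on the box is finite: `∑_{i<j} w ≤ M²∑|yᵢ-yⱼ|⁻¹`,
which is integrable on `Λ^n` (`CoulombBoxIntegrability.lean`). [folklore] -/
theorem setLIntegral_boxPair_mul_normSq_ne_top (hθ : ∀ x, 0 ≤ θ x) (hM : ∀ x, θ x ≤ M)
    (hν : 0 ≤ ν) {ψ : Config n → ℂ} {B : ℝ} (hB : ∀ Y ∈ boxN n ℓ, ‖ψ Y‖ ≤ B) :
    ∫⁻ Y in boxN n ℓ, ENNReal.ofReal (boxPair θ ν Y) * (‖ψ Y‖₊ : ℝ≥0∞) ^ 2 ≠ ⊤ := by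
  have hM0 : 0 ≤ M := (hθ 0).trans (hM 0)
  have hpt : ∀ Y ∈ boxN n ℓ, ENNReal.ofReal (boxPair θ ν Y) * (‖ψ Y‖₊ : ℝ≥0∞) ^ 2 ≤
      ENNReal.ofReal (M ^ 2) * (∑ i, ∑ j with i < j, ENNReal.ofReal ‖Y i - Y j‖⁻¹) *
        ENNReal.ofReal (B ^ 2) := by
    intro Y hY
    refine mul_le_mul' ?_ ?_
    · refine (ENNReal.ofReal_le_ofReal (boxPair_le hθ hM hν Y)).trans (le_of_eq ?_)
      rw [ENNReal.ofReal_mul (sq_nonneg M), ENNReal.ofReal_sum_of_nonneg fun i _ =>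
        Finset.sum_nonneg fun j _ => inv_nonneg.2 (norm_nonneg _)]
      congr 1
      exact Finset.sum_congr rfl fun i _ => ENNReal.ofReal_sum_of_nonneg fun j _ =>
        inv_nonneg.2 (norm_nonneg _)
    · rw [← ofReal_norm_sq_eq]
      exact ENNReal.ofReal_le_ofReal (pow_le_pow_left₀ (norm_nonneg _) (hB Y hY) 2)
  refine ne_top_of_le_ne_top ?_ (setLIntegral_mono' (measurableSet_boxN n ℓ) hpt)
  rw [lintegral_mul_const' _ _ ENNReal.ofReal_ne_top, lintegral_const_mul' _ _ ENNReal.ofReal_ne_top]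
  exact ENNReal.mul_ne_top (ENNReal.mul_ne_top ENNReal.ofReal_ne_top
    (setLIntegral_boxN_sum_inv_norm_sub_ne_top n ℓ)) ENNReal.ofReal_ne_top

/-- The pair expectation of a trial state is finite. [folklore] -/
theorem boxPairExpectation_ne_top (hθ : ∀ x, 0 ≤ θ x) (hM : ∀ x, θ x ≤ M) (hν : 0 ≤ ν)
    (Φ : NeumannTrialState n ℓ) : boxPairExpectation θ ν Φ ≠ ⊤ := by
  obtain ⟨B, hB⟩ := exists_bound_on_boxN Φ.contDiff.continuous ℓ
  exact setLIntegral_boxPair_mul_normSq_ne_top hθ hM hν hB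

end Finiteness

/-! ### API: the a priori lower bound and the variational principle -/

section Variational

variable {θ : Space → ℝ} {ν M : ℝ}

/-- **A priori lower bound**: `⟨Φ, H^n_ℓ Φ⟩ ≥ -gρ · n M²‖Y_ν‖₁` for `κ, g, ρ ≥ 0`,
`0 ≤ θ ≤ M` (drop the nonnegative kinetic, pair and background terms; the attraction is at most
`n M²‖Y_ν‖₁` per unit density). [cite: LiebSolovej2001, §3 (3.9)] -/
theorem boxEnergy_ge {κ g ρ : ℝ} (hκ : 0 ≤ κ) (hg : 0 ≤ g) (hρ : 0 ≤ ρ)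
    (hθ : ∀ x, 0 ≤ θ x) (hM : ∀ x, θ x ≤ M) (hν : 0 < ν) (Φ : NeumannTrialState n ℓ) :
    -(g * ρ * (n * (M * (M * ∫ y, yukawa ν y)))) ≤ boxEnergy κ g ρ θ ν Φ := by
  have h1 : 0 ≤ (boxKinetic Φ).toReal := ENNReal.toReal_nonneg
  have h2 : 0 ≤ (boxPairExpectation θ ν Φ).toReal := ENNReal.toReal_nonneg
  have h3 : (boxOneBodyExpectation θ ν Φ).toReal ≤ n * (M * (M * ∫ y, yukawa ν y)) := by
    have h := ENNReal.toReal_mono ENNReal.ofReal_ne_top (boxOneBodyExpectation_le hθ hM hν Φ)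
    rwa [ENNReal.toReal_ofReal] at h
    have hM0 : 0 ≤ M := (hθ 0).trans (hM 0)
    exact mul_nonneg (Nat.cast_nonneg _) (mul_nonneg hM0 (mul_nonneg hM0
      (integral_nonneg fun y => yukawa_nonneg ν y)))
  have h4 : 0 ≤ boxBackgroundSelfEnergy θ ν :=
    mul_nonneg (by norm_num) (integral_nonneg fun x =>
      mul_nonneg (hθ x) (smearedBackground_nonneg hθ ν x))
  unfold boxEnergy
  nlinarith [mul_nonneg hg h2, mul_nonneg hκ h1, mul_nonneg (mul_nonneg hg (sq_nonneg ρ)) h4,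
    mul_le_mul_of_nonneg_left h3 (mul_nonneg hg hρ)]

/-- The set of energies of Bose-symmetric trial states is bounded below. [folklore] -/
theorem bddBelow_range_boxEnergy {κ g ρ : ℝ} (hκ : 0 ≤ κ) (hg : 0 ≤ g) (hρ : 0 ≤ ρ)
    (hθ : ∀ x, 0 ≤ θ x) (hM : ∀ x, θ x ≤ M) (hν : 0 < ν) :
    BddBelow (Set.range fun Φ : {Φ : NeumannTrialState n ℓ // IsBoseSymmetric Φ.ψ} =>
      boxEnergy κ g ρ θ ν Φ.1) :=
  ⟨-(g * ρ * (n * (M * (M * ∫ y, yukawa ν y)))), by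
    rintro _ ⟨Φ, rfl⟩
    exact boxEnergy_ge hκ hg hρ hθ hM hν Φ.1⟩

/-- **Variational principle**: `inf Spec H^n_ℓ ≤ ⟨Φ, H^n_ℓ Φ⟩` for every Bose-symmetric trial
state `Φ`. [cite: LiebSolovej2001, Lemma 3.2 (proof)] -/
theorem boxGroundStateEnergy_le {κ g ρ : ℝ} (hκ : 0 ≤ κ) (hg : 0 ≤ g) (hρ : 0 ≤ ρ)
    (hθ : ∀ x, 0 ≤ θ x) (hM : ∀ x, θ x ≤ M) (hν : 0 < ν)
    (Φ : NeumannTrialState n ℓ) (hΦ : IsBoseSymmetric Φ.ψ) :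
    boxGroundStateEnergy κ g ρ θ ν n ℓ ≤ boxEnergy κ g ρ θ ν Φ :=
  ciInf_le (bddBelow_range_boxEnergy hκ hg hρ hθ hM hν) ⟨Φ, hΦ⟩

/-- **The constant is a Bose-symmetric Neumann trial state** (`ℓ > 0`): normalised constant
`|Λ_ℓ^n|^{-1/2}`. [cite: LSSY2005, Ch. 2 (after (2.2))] -/
theorem exists_isBoseSymmetric (n : ℕ) {ℓ : ℝ} (hℓ : 0 < ℓ) :
    ∃ Φ : NeumannTrialState n ℓ, IsBoseSymmetric Φ.ψ ∧ ∀ Y, Φ.ψ Y = Φ.ψ 0 := by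
  have hvol : volume (boxN n ℓ) = (ENNReal.ofReal ℓ ^ 3) ^ n := volume_boxN n ℓ
  have hv0 : volume (boxN n ℓ) ≠ 0 := by
    rw [hvol]; exact pow_ne_zero _ (pow_ne_zero _ (by rwa [Ne, ENNReal.ofReal_eq_zero, not_le]))
  have hvt : volume (boxN n ℓ) ≠ ⊤ := (volume_boxN_lt_top n ℓ).ne
  set m : ℝ := (volume (boxN n ℓ)).toReal with hm
  have hmpos : 0 < m := ENNReal.toReal_pos hv0 hvt
  set c : ℝ := Real.sqrt m⁻¹ with hc
  have hc0 : 0 ≤ c := Real.sqrt_nonneg _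
  have hc2 : ENNReal.ofReal (c ^ 2) = (volume (boxN n ℓ))⁻¹ := by
    rw [hc, Real.sq_sqrt (inv_nonneg.2 hmpos.le), ENNReal.ofReal_inv_of_pos hmpos, hm,
      ENNReal.ofReal_toReal hvt]
  refine ⟨{ ψ := fun _ => (c : ℂ)
            contDiff := contDiff_const
            norm_eq := ?_ }, fun σ X => rfl, fun Y => rfl⟩
  show ∫⁻ _ in boxN n ℓ, (‖(c : ℂ)‖₊ : ℝ≥0∞) ^ 2 = 1
  rw [setLIntegral_const, ← ofReal_norm_sq_eq, Complex.norm_real, Real.norm_eq_abs, sq_abs, hc2,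
    ENNReal.inv_mul_cancel hv0 hvt]

/-- The index type of the infimum is nonempty for `ℓ > 0`. [folklore] -/
theorem nonempty_isBoseSymmetric (n : ℕ) {ℓ : ℝ} (hℓ : 0 < ℓ) :
    Nonempty {Φ : NeumannTrialState n ℓ // IsBoseSymmetric Φ.ψ} := by
  obtain ⟨Φ, hΦ, -⟩ := exists_isBoseSymmetric n hℓ
  exact ⟨⟨Φ, hΦ⟩⟩

/-- **Lower bounds transfer to the infimum**: if `c ≤ ⟨Φ, H^n_ℓ Φ⟩` for every Bose-symmetric trial
state then `c ≤ inf Spec H^n_ℓ` (`ℓ > 0`). [cite: LiebSolovej2001, Lemma 3.3] -/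
theorem le_boxGroundStateEnergy {κ g ρ : ℝ} {θ : Space → ℝ} {ν : ℝ} (hℓ : 0 < ℓ) {c : ℝ}
    (h : ∀ Φ : NeumannTrialState n ℓ, IsBoseSymmetric Φ.ψ → c ≤ boxEnergy κ g ρ θ ν Φ) :
    c ≤ boxGroundStateEnergy κ g ρ θ ν n ℓ := by
  haveI := nonempty_isBoseSymmetric n hℓ
  exact le_ciInf fun Φ => h Φ.1 Φ.2

/-- In particular `inf Spec H^n_ℓ ≥ -gρ n M²‖Y_ν‖₁`. [cite: LiebSolovej2001, §3] -/
theorem boxGroundStateEnergy_ge {κ g ρ : ℝ} (hκ : 0 ≤ κ) (hg : 0 ≤ g) (hρ : 0 ≤ ρ)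
    (hθ : ∀ x, 0 ≤ θ x) (hM : ∀ x, θ x ≤ M) (hν : 0 < ν) (hℓ : 0 < ℓ) :
    -(g * ρ * (n * (M * (M * ∫ y, yukawa ν y)))) ≤ boxGroundStateEnergy κ g ρ θ ν n ℓ :=
  le_boxGroundStateEnergy hℓ fun Φ _ => boxEnergy_ge hκ hg hρ hθ hM hν Φ

end Variational

/-! ### The variational principle for unnormalised wave functions -/

section Scaling

variable {θ : Space → ℝ} {ν M : ℝ}

/-- Bose symmetry is preserved by scalar multiplication. [folklore] -/
theorem IsBoseSymmetric.const_mul {φ : Config n → ℂ} (hφ : IsBoseSymmetric φ) (c : ℂ) :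
    IsBoseSymmetric fun Y => c * φ Y := fun σ X => by
  show c * φ (X ∘ σ) = c * φ X
  rw [hφ σ X]

/-- **Variational principle, scaling form** [LiebSolovej2001, proof of Lemma 3.2 ("it is clear
that `(Ψ, H̃Ψ) ≥ inf_n E^n`")]: for every Bose-symmetric `C¹` function `φ` on `(ℝ³)^n` with mass
`m = ∫_{Λ^n}|φ|²`, pair term `P = ∫_{Λ^n}(∑_{i<j}w)|φ|²` and background term
`B = ∫_{Λ^n}(∑ⱼθU)|φ|²`, and `κ, g, ρ ≥ 0`, `0 ≤ θ ≤ M`, `ν > 0` (in `ℝ≥0∞`, read through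
`toReal`; the three integrals are finite for bounded `φ`),
`(inf Spec H^n_ℓ) · m ≤ κ ∫_{Λ^n}|∇φ|² + g (P - ρ B) + g ρ² (½∬w) m`.
[cite: LiebSolovej2001, Lemma 3.2 (proof)] -/
theorem boxGroundStateEnergy_mul_le {κ g ρ : ℝ} (hκ : 0 ≤ κ) (hg : 0 ≤ g) (hρ : 0 ≤ ρ)
    (hθ : ∀ x, 0 ≤ θ x) (hM : ∀ x, θ x ≤ M) (hν : 0 < ν)
    {φ : Config n → ℂ} (hφ : ContDiff ℝ 1 φ) (hsymm : IsBoseSymmetric φ) :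
    boxGroundStateEnergy κ g ρ θ ν n ℓ * (∫⁻ Y in boxN n ℓ, (‖φ Y‖₊ : ℝ≥0∞) ^ 2).toReal ≤
      κ * (∫⁻ Y in boxN n ℓ, kineticDensity φ Y).toReal +
        g * ((∫⁻ Y in boxN n ℓ, ENNReal.ofReal (boxPair θ ν Y) * (‖φ Y‖₊ : ℝ≥0∞) ^ 2).toReal -
          ρ * (∫⁻ Y in boxN n ℓ, ENNReal.ofReal (boxOneBody θ ν Y) *
            (‖φ Y‖₊ : ℝ≥0∞) ^ 2).toReal) +
        g * ρ ^ 2 * boxBackgroundSelfEnergy θ ν *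
          (∫⁻ Y in boxN n ℓ, (‖φ Y‖₊ : ℝ≥0∞) ^ 2).toReal := by
  set mE : ℝ≥0∞ := ∫⁻ Y in boxN n ℓ, (‖φ Y‖₊ : ℝ≥0∞) ^ 2 with hmE
  have hmtop : mE ≠ ⊤ := (lintegral_boxN_normSq_lt_top hφ.continuous ℓ).ne
  -- the case of zero mass
  rcases eq_or_ne mE 0 with hm0 | hm0
  · have hae : ∀ᵐ Y ∂(volume.restrict (boxN n ℓ)), (‖φ Y‖₊ : ℝ≥0∞) ^ 2 = 0 :=
      (lintegral_eq_zero_iff (measurable_normSq hφ.continuous)).1 hm0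
    have hP0 : ∫⁻ Y in boxN n ℓ, ENNReal.ofReal (boxPair θ ν Y) * (‖φ Y‖₊ : ℝ≥0∞) ^ 2 = 0 := by
      refine (lintegral_congr_ae ?_).trans lintegral_zero
      filter_upwards [hae] with Y hY
      rw [hY, mul_zero]
    have hB0 : ∫⁻ Y in boxN n ℓ, ENNReal.ofReal (boxOneBody θ ν Y) * (‖φ Y‖₊ : ℝ≥0∞) ^ 2 = 0 := by
      refine (lintegral_congr_ae ?_).trans lintegral_zero
      filter_upwards [hae] with Y hY
      rw [hY, mul_zero]
    rw [hm0, hP0, hB0]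
    simp only [ENNReal.toReal_zero, mul_zero, sub_zero, add_zero]
    exact mul_nonneg hκ ENNReal.toReal_nonneg
  -- positive mass: normalise
  have hmpos : 0 < mE.toReal := ENNReal.toReal_pos hm0 hmtop
  set c : ℝ := Real.sqrt (mE.toReal)⁻¹ with hc
  have hc0 : 0 ≤ c := Real.sqrt_nonneg _
  have hc2r : c ^ 2 = (mE.toReal)⁻¹ := by rw [hc, Real.sq_sqrt (inv_nonneg.2 hmpos.le)]
  have hc2 : ENNReal.ofReal (c ^ 2) = mE⁻¹ := by
    rw [hc2r, ENNReal.ofReal_inv_of_pos hmpos, ENNReal.ofReal_toReal hmtop]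
  let Ψ : NeumannTrialState n ℓ :=
    { ψ := fun Y => (c : ℂ) * φ Y
      contDiff := contDiff_const.mul hφ
      norm_eq := by
        simp only [ennorm_real_mul_sq c hc0]
        rw [lintegral_const_mul' _ _ ENNReal.ofReal_ne_top, hc2]
        exact ENNReal.inv_mul_cancel hm0 hmtop }
  have hΨsymm : IsBoseSymmetric Ψ.ψ := hsymm.const_mul _
  -- the three expectations of `Ψ`
  have hK : boxKinetic Ψ = mE⁻¹ * ∫⁻ Y in boxN n ℓ, kineticDensity φ Y := by
    unfold boxKinetic
    rw [← hc2, ← lintegral_const_mul' _ _ ENNReal.ofReal_ne_top]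
    refine lintegral_congr fun Y => ?_
    exact kineticDensity_const_mul hφ c hc0 Y
  have hPP : boxPairExpectation θ ν Ψ =
      mE⁻¹ * ∫⁻ Y in boxN n ℓ, ENNReal.ofReal (boxPair θ ν Y) * (‖φ Y‖₊ : ℝ≥0∞) ^ 2 := by
    unfold boxPairExpectation
    rw [← hc2, ← lintegral_const_mul' _ _ ENNReal.ofReal_ne_top]
    refine lintegral_congr fun Y => ?_
    change ENNReal.ofReal (boxPair θ ν Y) * ((‖(c : ℂ) * φ Y‖₊ : ℝ≥0∞)) ^ 2 = _
    rw [ennorm_real_mul_sq c hc0]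
    ring
  have hPB : boxOneBodyExpectation θ ν Ψ =
      mE⁻¹ * ∫⁻ Y in boxN n ℓ, ENNReal.ofReal (boxOneBody θ ν Y) * (‖φ Y‖₊ : ℝ≥0∞) ^ 2 := by
    unfold boxOneBodyExpectation
    rw [← hc2, ← lintegral_const_mul' _ _ ENNReal.ofReal_ne_top]
    refine lintegral_congr fun Y => ?_
    change ENNReal.ofReal (boxOneBody θ ν Y) * ((‖(c : ℂ) * φ Y‖₊ : ℝ≥0∞)) ^ 2 = _
    rw [ennorm_real_mul_sq c hc0]
    ring
  have hvar := boxGroundStateEnergy_le hκ hg hρ hθ hM hν Ψ hΨsymm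
  unfold boxEnergy at hvar
  rw [hK, hPP, hPB, ENNReal.toReal_mul, ENNReal.toReal_mul, ENNReal.toReal_mul,
    ENNReal.toReal_inv] at hvar
  -- multiply by the mass
  have hm' : (mE.toReal)⁻¹ * mE.toReal = 1 := inv_mul_cancel₀ hmpos.ne'
  have key := mul_le_mul_of_nonneg_right hvar hmpos.le
  calc boxGroundStateEnergy κ g ρ θ ν n ℓ * mE.toReal
      ≤ (κ * ((mE.toReal)⁻¹ * (∫⁻ Y in boxN n ℓ, kineticDensity φ Y).toReal) +
          g * ((mE.toReal)⁻¹ * (∫⁻ Y in boxN n ℓ, ENNReal.ofReal (boxPair θ ν Y) *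
              (‖φ Y‖₊ : ℝ≥0∞) ^ 2).toReal -
            ρ * ((mE.toReal)⁻¹ * (∫⁻ Y in boxN n ℓ, ENNReal.ofReal (boxOneBody θ ν Y) *
              (‖φ Y‖₊ : ℝ≥0∞) ^ 2).toReal) +
            ρ ^ 2 * boxBackgroundSelfEnergy θ ν)) * mE.toReal := key
    _ = _ := by
        have e : ∀ A : ℝ, (mE.toReal)⁻¹ * A * mE.toReal = A := fun A => by
          rw [mul_comm, ← mul_assoc, mul_comm (mE.toReal), hm', one_mul]
        calc _ = κ * ((mE.toReal)⁻¹ * (∫⁻ Y in boxN n ℓ, kineticDensity φ Y).toReal * mE.toReal) +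
              g * ((mE.toReal)⁻¹ * (∫⁻ Y in boxN n ℓ, ENNReal.ofReal (boxPair θ ν Y) *
                  (‖φ Y‖₊ : ℝ≥0∞) ^ 2).toReal * mE.toReal -
                ρ * ((mE.toReal)⁻¹ * (∫⁻ Y in boxN n ℓ, ENNReal.ofReal (boxOneBody θ ν Y) *
                  (‖φ Y‖₊ : ℝ≥0∞) ^ 2).toReal * mE.toReal)) +
              g * ρ ^ 2 * boxBackgroundSelfEnergy θ ν * mE.toReal := by ring
          _ = _ := by rw [e, e, e]

end Scaling

end Literature.MathematicalPhysics.QuantumManyBody.JelliumBoseGas
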